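import Summits.QuantumFields.BalabanUV.Beta.ResolventBlockCertificate
import Summits.QuantumFields.BalabanUV.Beta.CapRouteASchedules
import Mathlib.Analysis.Real.Pi.Bounds

/-!
# Beta / ResolventLeafRecord — THE ENGINES' LEAF RECORD AS A KERNEL OBJECT: a block-leaf record over `ℚ` with a DECIDABLE validity predicate
# (the sqrt-free criterion `hp ∧ hq₂ ∧ hr`), `certifies` through `box_certificate_of_blocks_reindex`, rational-root schedules, and route A's
# anchor over (schedule, records) (β sub-cell, BINDER-OWNERS row CAP-k, lineage `b2b-balaban-beta-an5`, gen 26; node BETA-an5-g26-SCHEDULES,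
# leaf 3; journal CLAIM l.17735)

cap1-g11's L-CF implementation #2 writes, per box, an exact record `record-v1` (journal l.17667, `README-LCF2.md` v1.3 §12) «keyed to
`box_certificate_of_blocks_reindex`'s binders»: the box `(c_re, c_im, h)`, the four block sups `a ≥ sup‖G_vv‖`, `b ≥ sup‖X‖`, `c′ ≥ sup‖Y‖`,
`e′ ≥ sup‖Z‖`, a budget `B`, and the criterion `hp ∧ hq₂ ∧ hr` at `B` checked in exact rationals; its successor list names «(4) cap-ref's
admission of the record format» as one of four things the row needs.  cap3's v5r tier (l.17547) verifies the same criterion in exact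
`fractions`.  THIS LEAF types that record in the kernel, so that its admission is a question about a named Lean structure:

* §1 RATIONAL-ROOT SCHEDULES for the quarter region: the real root box `[−R, R]^{d} × [−R, 0]` for any rational `R ≥ π` (e.g. cap1's dyadic
  stand-in `3217/1024`, `pi_le_piQ`) instead of `[−π, π]^{d} × [−π, 0]` — so every leaf of a dyadic schedule is a DYADIC RATIONAL box, the
  boxes engines actually state (`quarterBoxesQ`, `hcov_of_schedulesQ`: coverage still a theorem);
* §2 **`BlockLeafRecord d`** — `(cRe, cIm, h, a, b, c′, e′, B)` over `ℚ`; `box`; **`Valid`** = `0 ≤ B ∧ hp ∧ hq₂ ∧ hr` with a `Decidable`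
  instance (kernel-checkable per leaf by `decide +kernel` ∕ `norm_num` — plain `decide` does not reduce `Rat` arithmetic); **`certifies`**: `Valid` + the four sups on the box + the closed-form identity
  `hG` ⟹ `IsUnit (A q).det ∧ ‖(A q)⁻¹‖ ≤ B` on the box — `box_certificate_of_blocks_reindex` with the arithmetic discharged from `ℚ`;
* §3 **`hcert_of_records`**: a record per box of a list, all valid with `B ≤ Ba`, boxes inside the records' boxes, sups + `hG` per record ⟹
  the binder `hcert` of every route-A anchor;
* §4 the anchors **`rowsOfOneLoopFormCode16E_routeA₂_ofSchedulesQ`** (rational root) and **`…_ofRecords`** = the row's typed target whose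
  (Z2a)+(F) side is: schedule DATA `S`, record DATA `rec`, the decidable `Valid ∧ B ≤ Ba` per leaf, box inclusion per leaf, and per leaf the
  FOUR SUPS + `hG` — nothing else; `_k₀ = 0`.

WHAT STAYS OUTSIDE THE KERNEL, exactly (census v1.7 V30): per leaf the four sup inequalities (two independent engines, R81-d) and `hG` (the
E1′∕O4′ closed form of `k₀⁻¹` — cap3 (ii) EXPORT, GO-gated); plus (N), (Z2b), (T), the fin leaves and `hR` as before.

HONEST FRAMING.  Kernel glue ([folklore]); no record for the cell's `k₀` is typed here, no box, no number supplied or asserted; the worked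
`example` checks the criterion on ILLUSTRATIVE three-decimal rationals only (not a certificate, not a leaf of any cover); 0 binders instantiated;
0 certified coefficients.  Discharging `BetaPertH` would make Bałaban's ultraviolet stability unconditional — NOT the continuum limit, NOT the
Clay problem.  HONEST DEPENDENCY: continuum YM on T⁴ ⇐ BetaPertH ∧ nine spine estimates (0/9 proved); BetaPertH ⇐ (D1) ∧ (D4) ∧ CAP+tail; G-an2-4 gates asym, D1 and NE2/3/4.
v1.0.1 (DOCFIX, XREAD beta-num-g40 l.18870 F1∕I1): docstrings only — `decide +kernel`, the dependency line; declarations byte-identical.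
0 `sorry`, 0 cite tags.
-/

namespace Summit.QuantumFields.BalabanUV.Beta.ResolventLeafRecord

open Complex Set Matrix
open Literature.MathematicalPhysics.QuantumFieldTheory.Balaban1983to89
open B4Strip (Strip)
open B4ContourShift (latticeKernel)
open B4TorusKernel (descend gridPt)
open Beta.AliasingTailL1 (aliasRatioL1)
open Beta.AliasingTailLattice (codeTheta code16SetE)
open Summit.QuantumFields.BalabanUV.Beta.CapRows (Rows)
open Summit.QuantumFields.BalabanUV.Beta.TubeMaximumModulus
open Summit.QuantumFields.BalabanUV.Beta.VertexToriSymmetry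
open Summit.QuantumFields.BalabanUV.Beta.ConjReflectionAlgebra (MatConjSymm)
open Summit.QuantumFields.BalabanUV.Beta.ResolventBoxCertificate (Box box_certificate_of_blocks_reindex)
open Summit.QuantumFields.BalabanUV.Beta.CoverSchedules
open Summit.QuantumFields.BalabanUV.Beta.CapRouteAFins (rowsOfOneLoopFormCode16E_routeA₂_ofBoxesRealShift_ofReflect_ofFinRects)
open scoped Real Matrix.Norms.L2Operator

noncomputable section

variable {d : ℕ}

/-! ## §1 Rational-root schedules for the quarter region -/

section RationalRoot

/-- cap1's dyadic stand-in for `π` bounds it from above: `π ≤ 3217/1024`. [folklore] -/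
theorem pi_le_piQ : π ≤ ((3217 / 1024 : ℚ) : ℝ) := by
  have h := Real.pi_lt_d6
  have e : ((3217 / 1024 : ℚ) : ℝ) = 3.1416015625 := by norm_num
  rw [e]; linarith

/-- the RATIONAL ROOT BOX of the quarter region in real parts: `[−R, 0]` along `ν₁`, `[−R, R]` elsewhere — centre. [folklore] -/
def quarterRootCtrQ (R : ℚ) (ν₁ : Fin (d + 1)) : Fin (d + 1) → ℝ := fun μ => if μ = ν₁ then -((R : ℝ) / 2) else 0
/-- the RATIONAL ROOT BOX — half-widths. [folklore] -/
def quarterRootHwQ (R : ℚ) (ν₁ : Fin (d + 1)) : Fin (d + 1) → ℝ := fun μ => if μ = ν₁ then (R : ℝ) / 2 else R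

/-- for `R ≥ π` the real part of a quarter-region point lies in the rational root box. [folklore] -/
theorem re_mem_quarterRootQ {R : ℚ} (hR : π ≤ (R : ℝ)) {w : Fin (d + 1) → ℝ} (ν₁ : Fin (d + 1)) {q : Fin (d + 1) → ℂ}
    (hq : q ∈ VertexTori w) (h1 : (q ν₁).re ≤ 0) : (fun μ => (q μ).re) ∈ RBox (quarterRootCtrQ R ν₁) (quarterRootHwQ R ν₁) := by
  intro μ
  have hre := abs_le.mp (hq μ).1
  by_cases hμ : μ = ν₁
  · subst hμ
    simp only [quarterRootCtrQ, quarterRootHwQ, if_true]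
    rw [abs_le]; constructor <;> linarith
  · simp only [quarterRootCtrQ, quarterRootHwQ, hμ, if_false, sub_zero]
    exact abs_le.mpr ⟨by linarith, by linarith⟩

open scoped Classical in
/-- the box list of a family of schedules on the RATIONAL root boxes (dyadic leaves for dyadic schedules when `R` is dyadic). [folklore] -/
def quarterBoxesQ (w : Fin (d + 1) → ℝ) (R : ℚ) (ν₀ ν₁ : Fin (d + 1)) (S : (Fin (d + 1) → Bool) → Sched d) :
    Finset ((Fin (d + 1) → ℂ) × (Fin (d + 1) → ℝ)) :=
  (Finset.univ.filter fun s : Fin (d + 1) → Bool => s ν₀ = true).biUnion fun s =>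
    ((S s).leaves (quarterRootCtrQ R ν₁) (quarterRootHwQ R ν₁)).image (cbox (signVec w s))

open scoped Classical in
/-- membership in the rational-root box list. [folklore] -/
theorem mem_quarterBoxesQ {w : Fin (d + 1) → ℝ} {R : ℚ} {ν₀ ν₁ : Fin (d + 1)} {S : (Fin (d + 1) → Bool) → Sched d}
    {bxc : (Fin (d + 1) → ℂ) × (Fin (d + 1) → ℝ)} :
    bxc ∈ quarterBoxesQ w R ν₀ ν₁ S ↔ ∃ s : Fin (d + 1) → Bool, s ν₀ = true ∧
      ∃ bx ∈ (S s).leaves (quarterRootCtrQ R ν₁) (quarterRootHwQ R ν₁), cbox (signVec w s) bx = bxc := by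
  simp only [quarterBoxesQ, Finset.mem_biUnion, Finset.mem_filter, Finset.mem_univ, true_and, Finset.mem_image]

/-- **`hcov` AS A THEOREM on the rational root**: for `R ≥ π` and EVERY family of schedules, `quarterBoxesQ w R ν₀ ν₁ S` covers the quarter region.
[folklore] -/
theorem hcov_of_schedulesQ (w : Fin (d + 1) → ℝ) {R : ℚ} (hR : π ≤ (R : ℝ)) (ν₀ ν₁ : Fin (d + 1)) (S : (Fin (d + 1) → Bool) → Sched d) :
    ∀ q ∈ VertexTori w, (q ν₀).im = w ν₀ → (q ν₁).re ≤ 0 →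
      ∃ bx ∈ quarterBoxesQ w R ν₀ ν₁ S, q ∈ Box (Prod.fst bx) (Prod.snd bx) := by
  intro q hq h0 h1
  set s : Fin (d + 1) → Bool := fun ν => decide ((q ν).im = w ν) with hs
  have hs0 : s ν₀ = true := by simp [hs, h0]
  have him : ∀ μ, (q μ).im = signVec w s μ := fun μ => im_eq_signVec hq μ
  obtain ⟨bx, hbx, hxb⟩ := Sched.cover (S s) _ _ (re_mem_quarterRootQ hR ν₁ hq h1)
  exact ⟨cbox (signVec w s) bx, mem_quarterBoxesQ.mpr ⟨s, hs0, bx, hbx, rfl⟩, mem_box_cbox him hxb⟩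

end RationalRoot

/-! ## §2 The block-leaf record over `ℚ` -/

/-- **THE BLOCK-LEAF RECORD** (cap1-g11 `record-v1` §12 ∕ the numeric content of `box_certificate_of_blocks_reindex`): a box — real centre `cRe`,
sign-class imaginary part `cIm`, half-widths `h` — the four block-norm sups `a, b, c′, e′` and the budget `B`, all EXACT RATIONALS. [folklore] -/
structure BlockLeafRecord (d : ℕ) where
  /-- real parts of the box centre. -/
  cRe : Fin (d + 1) → ℚ
  /-- imaginary parts of the box centre (the sign-class torus, `±κ`). -/
  cIm : Fin (d + 1) → ℚ
  /-- half-widths of the box. -/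
  h : Fin (d + 1) → ℚ
  /-- `a ≥ sup_box ‖G q‖` (variable–variable block of the inverse). -/
  a : ℚ
  /-- `b ≥ sup_box ‖X q‖`. -/
  b : ℚ
  /-- `c′ ≥ sup_box ‖Y q‖`. -/
  c' : ℚ
  /-- `e′ ≥ sup_box ‖Z q‖`. -/
  e' : ℚ
  /-- the budget: the record claims `‖(A q)⁻¹‖ ≤ B` on the box. -/
  B : ℚ

namespace BlockLeafRecord

variable (r : BlockLeafRecord d)

/-- the complex box centre `cRe + i·cIm`. [folklore] -/
def ctr : Fin (d + 1) → ℂ := fun μ => (((r.cRe μ : ℚ) : ℝ) : ℂ) + (((r.cIm μ : ℚ) : ℝ) : ℂ) * I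
/-- the real half-widths. [folklore] -/
def hw : Fin (d + 1) → ℝ := fun μ => ((r.h μ : ℚ) : ℝ)
/-- the record's box (`ResolventBoxCertificate.Box`). [folklore] -/
def box : Set (Fin (d + 1) → ℂ) := Box r.ctr r.hw

/-- **VALIDITY** = `0 ≤ B` and the sqrt-free criterion `hp ∧ hq₂ ∧ hr` of `box_certificate_of_blocks(_reindex)`, in exact rationals. [folklore] -/
def Valid : Prop :=
  0 ≤ r.B ∧ r.a ^ 2 + r.c' ^ 2 ≤ r.B ^ 2 ∧ r.b ^ 2 + r.e' ^ 2 ≤ r.B ^ 2 ∧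
    (r.a * r.b + r.c' * r.e') ^ 2 ≤ (r.B ^ 2 - (r.a ^ 2 + r.c' ^ 2)) * (r.B ^ 2 - (r.b ^ 2 + r.e' ^ 2))

/-- validity is DECIDABLE (rational arithmetic): a record is checked in the kernel by `decide +kernel` ∕ `norm_num` (plain `decide` does not
reduce `Rat` arithmetic at default transparency — XREAD beta-num-g40 F1). [folklore] -/
instance decidableValid : Decidable r.Valid := by unfold Valid; infer_instance

variable {n v w : Type*} [Fintype n] [DecidableEq n] [Fintype v] [Fintype w] [DecidableEq v] [DecidableEq w]

/-- **A VALID RECORD CERTIFIES ITS BOX**: validity + the four sups on the box + the closed-form right-inverse identity `hG` (relabelled by the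
engine's variable ∕ constraint split `e`) ⟹ `A q` is invertible and `‖(A q)⁻¹‖ ≤ B` on the whole box. [folklore] -/
theorem certifies (hv : r.Valid) {A : (Fin (d + 1) → ℂ) → Matrix n n ℂ} (e : v ⊕ w ≃ n)
    (G : (Fin (d + 1) → ℂ) → Matrix v v ℂ) (X : (Fin (d + 1) → ℂ) → Matrix v w ℂ)
    (Y : (Fin (d + 1) → ℂ) → Matrix w v ℂ) (Z : (Fin (d + 1) → ℂ) → Matrix w w ℂ)
    (hG : ∀ q ∈ r.box, (A q).submatrix e e * fromBlocks (G q) (X q) (Y q) (Z q) = 1)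
    (ha : ∀ q ∈ r.box, ‖G q‖ ≤ r.a) (hb : ∀ q ∈ r.box, ‖X q‖ ≤ r.b) (hc : ∀ q ∈ r.box, ‖Y q‖ ≤ r.c')
    (he : ∀ q ∈ r.box, ‖Z q‖ ≤ r.e') :
    ∀ q ∈ r.box, IsUnit (A q).det ∧ ‖(A q)⁻¹‖ ≤ r.B := by
  obtain ⟨hB, hp, hq₂, hr⟩ := hv
  refine box_certificate_of_blocks_reindex e G X Y Z hG ha hb hc he ?_ ?_ ?_ ?_
  · exact_mod_cast hB
  · exact_mod_cast hp
  · exact_mod_cast hq₂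
  · exact_mod_cast hr

/-- with a uniform budget: `Valid ∧ B ≤ Ba` ⟹ `‖(A q)⁻¹‖ ≤ Ba` on the box. [folklore] -/
theorem certifies_le (hv : r.Valid) {Ba : ℝ} (hBa : (r.B : ℝ) ≤ Ba) {A : (Fin (d + 1) → ℂ) → Matrix n n ℂ} (e : v ⊕ w ≃ n)
    (G : (Fin (d + 1) → ℂ) → Matrix v v ℂ) (X : (Fin (d + 1) → ℂ) → Matrix v w ℂ)
    (Y : (Fin (d + 1) → ℂ) → Matrix w v ℂ) (Z : (Fin (d + 1) → ℂ) → Matrix w w ℂ)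
    (hG : ∀ q ∈ r.box, (A q).submatrix e e * fromBlocks (G q) (X q) (Y q) (Z q) = 1)
    (ha : ∀ q ∈ r.box, ‖G q‖ ≤ r.a) (hb : ∀ q ∈ r.box, ‖X q‖ ≤ r.b) (hc : ∀ q ∈ r.box, ‖Y q‖ ≤ r.c')
    (he : ∀ q ∈ r.box, ‖Z q‖ ≤ r.e') :
    ∀ q ∈ r.box, IsUnit (A q).det ∧ ‖(A q)⁻¹‖ ≤ Ba := fun q hq =>
  let h := r.certifies hv e G X Y Z hG ha hb hc he q hq
  ⟨h.1, h.2.trans hBa⟩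

end BlockLeafRecord

/-- ARITHMETIC DEMO (illustrative three-decimal rationals of the SIZE cap1-g11 displays for its worst-corner leaf, l.17667 — NOT the record's
exact values, NOT a certificate, NOT a leaf of any cover): the kernel DECIDES validity at `B = 780`. [folklore] -/
example : (⟨fun _ => 3217 / 1024, fun _ => 9 / 10, fun _ => 1 / 8, 183666 / 1000, 102569 / 1000, 65745 / 1000, 338409 / 1000, 780⟩ :
    BlockLeafRecord 3).Valid := by
  unfold BlockLeafRecord.Valid; norm_num

/-- … and REFUTES it at `B = 376` (the displayed `B_min` is `376.0047`). [folklore] -/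
example : ¬ (⟨fun _ => 3217 / 1024, fun _ => 9 / 10, fun _ => 1 / 8, 183666 / 1000, 102569 / 1000, 65745 / 1000, 338409 / 1000, 376⟩ :
    BlockLeafRecord 3).Valid := by
  unfold BlockLeafRecord.Valid; norm_num

/-! ## §3 `hcert` from records -/

section Records

variable {n v w : Type*} [Fintype n] [DecidableEq n] [Fintype v] [Fintype w] [DecidableEq v] [DecidableEq w]

/-- **`hcert` FROM RECORDS**: one record per box of a list, each valid with budget `≤ Ba`, each box inside its record's box, and per record the
four sups + `hG` ⟹ the binder `hcert : ∀ bx ∈ boxes, ∀ q ∈ Box bx.1 bx.2, IsUnit (A q).det ∧ ‖(A q)⁻¹‖ ≤ Ba` of every route-A anchor.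
[folklore] -/
theorem hcert_of_records {boxes : Finset ((Fin (d + 1) → ℂ) × (Fin (d + 1) → ℝ))}
    (rec : (Fin (d + 1) → ℂ) × (Fin (d + 1) → ℝ) → BlockLeafRecord d) {Ba : ℝ}
    (hvalid : ∀ bx ∈ boxes, (rec bx).Valid ∧ ((rec bx).B : ℝ) ≤ Ba)
    (hsub : ∀ bx ∈ boxes, Box bx.1 bx.2 ⊆ (rec bx).box)
    {A : (Fin (d + 1) → ℂ) → Matrix n n ℂ} (e : v ⊕ w ≃ n)
    (G : (Fin (d + 1) → ℂ) → Matrix v v ℂ) (X : (Fin (d + 1) → ℂ) → Matrix v w ℂ)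
    (Y : (Fin (d + 1) → ℂ) → Matrix w v ℂ) (Z : (Fin (d + 1) → ℂ) → Matrix w w ℂ)
    (hG : ∀ bx ∈ boxes, ∀ q ∈ (rec bx).box, (A q).submatrix e e * fromBlocks (G q) (X q) (Y q) (Z q) = 1)
    (hsup : ∀ bx ∈ boxes, (∀ q ∈ (rec bx).box, ‖G q‖ ≤ (rec bx).a) ∧ (∀ q ∈ (rec bx).box, ‖X q‖ ≤ (rec bx).b) ∧
      (∀ q ∈ (rec bx).box, ‖Y q‖ ≤ (rec bx).c') ∧ (∀ q ∈ (rec bx).box, ‖Z q‖ ≤ (rec bx).e')) :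
    ∀ bx ∈ boxes, ∀ q ∈ Box bx.1 bx.2, IsUnit (A q).det ∧ ‖(A q)⁻¹‖ ≤ Ba := by
  intro bx hbx q hq
  obtain ⟨ha, hb, hc, he⟩ := hsup bx hbx
  exact (rec bx).certifies_le (hvalid bx hbx).1 (hvalid bx hbx).2 e G X Y Z (hG bx hbx) ha hb hc he q (hsub bx hbx hq)

end Records

/-! ## §4 Route A's anchor on the rational root, and over records -/

section Anchor

variable {n : Type*} [Fintype n] [DecidableEq n]
variable {b : ℕ → ℝ} {A B C D : (Fin 4 → ℂ) → Matrix n n ℂ} {κ Ba Sst Ss St : ℝ} {c : Fin 4 → ℂ}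

/-- **THE TYPED TARGET ON A RATIONAL ROOT**: `CapRouteASchedules.rowsOfOneLoopFormCode16E_routeA₂_ofSchedules` with the schedules run on the
rational root boxes `[−R, R]³ × [−R, 0]`, `R ≥ π` (coverage `hcov_of_schedulesQ`). [folklore] -/
def rowsOfOneLoopFormCode16E_routeA₂_ofSchedulesQ
    (hb : b 0 = (latticeKernel (fun p => ((A p)⁻¹ * B p).trace - ((A p)⁻¹ * C p * (A (p - c))⁻¹ * D p).trace) 0).re)
    (hκ : 0 < κ) (hc : ∀ μ, (c μ).im = 0)
    (hA : MatTubeHol A (fun _ => κ)) (hA' : MatTubeHol (fun p => A (p - c)) (fun _ => κ))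
    (hBst : MatTubeHol B (fun _ => κ)) (hBs : MatTubeHol C (fun _ => κ)) (hBt : MatTubeHol D (fun _ => κ))
    (hAn : MatNegTranspose A) (hAc : MatConjSymm A)
    {R : ℚ} (hR : π ≤ (R : ℝ)) (ν₀ ν₁ : Fin (3 + 1)) (S : (Fin (3 + 1) → Bool) → Sched 3)
    (hcert : ∀ bx ∈ quarterBoxesQ (fun _ : Fin (3 + 1) => κ) R ν₀ ν₁ S, ∀ q ∈ Box bx.1 bx.2, IsUnit (A q).det ∧ ‖(A q)⁻¹‖ ≤ Ba)
    (hRfl : ∀ (ν : Fin (3 + 1)) (p : Fin (3 + 1) → ℂ), (A (reflectAt ν p)).det = (A p).det)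
    (F : Fin (3 + 1) → Sched 1)
    (hcertF : ∀ (i : Fin (3 + 1)), ∀ bx ∈ finRects (F i), ∀ τ x : ℝ, |τ - bx.1 0| ≤ bx.2 0 → |x - bx.1 1| ≤ bx.2 1 →
      IsUnit (A (i.insertNth ((x : ℂ) + ((τ * κ : ℝ) : ℂ) * I) fun _ => ((τ * κ : ℝ) : ℂ) * I)).det)
    (hSst : ∀ p ∈ VertexTori (fun _ : Fin (3 + 1) => κ), ‖B p‖ ≤ Sst)
    (hSs : ∀ p ∈ VertexTori (fun _ : Fin (3 + 1) => κ), ‖C p‖ ≤ Ss)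
    (hSt : ∀ p ∈ VertexTori (fun _ : Fin (3 + 1) => κ), ‖D p‖ ≤ St)
    {N : ℕ} (hN : 1 ≤ N) [NeZero (4 * N)] {t r : ℝ}
    (hT : ‖((code16SetE N).card : ℂ)⁻¹ *
        (∑ w ∈ code16SetE N, descend (fun p => ((A p)⁻¹ * B p).trace - ((A p)⁻¹ * C p * (A (p - c))⁻¹ * D p).trace)
          (gridPt (4 * N) w)) - t‖ ≤ r)
    {A₀ : ℝ} (hA₀ : Fintype.card n * (Ba * Sst + Ba * Ss * Ba * St) * codeTheta (aliasRatioL1 κ N) ≤ A₀) (lo : ℚ)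
    (hlo : ((lo : ℚ) : ℝ) ≤ t - r - A₀) : Rows b :=
  rowsOfOneLoopFormCode16E_routeA₂_ofBoxesRealShift_ofReflect_ofFinRects hb hκ hc hA hA' hBst hBs hBt hAn hAc ν₀ ν₁
    (quarterBoxesQ (fun _ : Fin (3 + 1) => κ) R ν₀ ν₁ S) Prod.fst Prod.snd (hcov_of_schedulesQ _ hR ν₀ ν₁ S) hcert hRfl
    (fun i => finRects (F i)) (fun _ bx => bx.1 0) (fun _ bx => bx.1 1) (fun _ bx => bx.2 0) (fun _ bx => bx.2 1)
    (hcovF_of_schedules F) hcertF hSst hSs hSt hN hT hA₀ lo hlo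

variable {v u : Type*} [Fintype v] [Fintype u] [DecidableEq v] [DecidableEq u]

/-- **THE TYPED TARGET OVER (SCHEDULE, RECORDS)**: the (Z2a)+(F) side of the row = schedule DATA `S` on the rational root, one `BlockLeafRecord`
per kernel leaf (`rec`), per leaf the DECIDABLE `Valid ∧ B ≤ Ba`, the box inclusion, and per leaf the FOUR SUPS + the closed form `hG` — the
latter two being exactly what stays outside the kernel (two engines; cap3 (ii) EXPORT). [folklore] -/
def rowsOfOneLoopFormCode16E_routeA₂_ofRecords
    (hb : b 0 = (latticeKernel (fun p => ((A p)⁻¹ * B p).trace - ((A p)⁻¹ * C p * (A (p - c))⁻¹ * D p).trace) 0).re)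
    (hκ : 0 < κ) (hc : ∀ μ, (c μ).im = 0)
    (hA : MatTubeHol A (fun _ => κ)) (hA' : MatTubeHol (fun p => A (p - c)) (fun _ => κ))
    (hBst : MatTubeHol B (fun _ => κ)) (hBs : MatTubeHol C (fun _ => κ)) (hBt : MatTubeHol D (fun _ => κ))
    (hAn : MatNegTranspose A) (hAc : MatConjSymm A)
    {R : ℚ} (hR : π ≤ (R : ℝ)) (ν₀ ν₁ : Fin (3 + 1)) (S : (Fin (3 + 1) → Bool) → Sched 3)
    (rec : (Fin (3 + 1) → ℂ) × (Fin (3 + 1) → ℝ) → BlockLeafRecord 3)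
    (hvalid : ∀ bx ∈ quarterBoxesQ (fun _ : Fin (3 + 1) => κ) R ν₀ ν₁ S, (rec bx).Valid ∧ ((rec bx).B : ℝ) ≤ Ba)
    (hsub : ∀ bx ∈ quarterBoxesQ (fun _ : Fin (3 + 1) => κ) R ν₀ ν₁ S, Box bx.1 bx.2 ⊆ (rec bx).box)
    (e : v ⊕ u ≃ n) (G : (Fin (3 + 1) → ℂ) → Matrix v v ℂ) (X : (Fin (3 + 1) → ℂ) → Matrix v u ℂ)
    (Y : (Fin (3 + 1) → ℂ) → Matrix u v ℂ) (Z : (Fin (3 + 1) → ℂ) → Matrix u u ℂ)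
    (hG : ∀ bx ∈ quarterBoxesQ (fun _ : Fin (3 + 1) => κ) R ν₀ ν₁ S, ∀ q ∈ (rec bx).box,
      (A q).submatrix e e * fromBlocks (G q) (X q) (Y q) (Z q) = 1)
    (hsup : ∀ bx ∈ quarterBoxesQ (fun _ : Fin (3 + 1) => κ) R ν₀ ν₁ S,
      (∀ q ∈ (rec bx).box, ‖G q‖ ≤ (rec bx).a) ∧ (∀ q ∈ (rec bx).box, ‖X q‖ ≤ (rec bx).b) ∧
      (∀ q ∈ (rec bx).box, ‖Y q‖ ≤ (rec bx).c') ∧ (∀ q ∈ (rec bx).box, ‖Z q‖ ≤ (rec bx).e'))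
    (hRfl : ∀ (ν : Fin (3 + 1)) (p : Fin (3 + 1) → ℂ), (A (reflectAt ν p)).det = (A p).det)
    (F : Fin (3 + 1) → Sched 1)
    (hcertF : ∀ (i : Fin (3 + 1)), ∀ bx ∈ finRects (F i), ∀ τ x : ℝ, |τ - bx.1 0| ≤ bx.2 0 → |x - bx.1 1| ≤ bx.2 1 →
      IsUnit (A (i.insertNth ((x : ℂ) + ((τ * κ : ℝ) : ℂ) * I) fun _ => ((τ * κ : ℝ) : ℂ) * I)).det)
    (hSst : ∀ p ∈ VertexTori (fun _ : Fin (3 + 1) => κ), ‖B p‖ ≤ Sst)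
    (hSs : ∀ p ∈ VertexTori (fun _ : Fin (3 + 1) => κ), ‖C p‖ ≤ Ss)
    (hSt : ∀ p ∈ VertexTori (fun _ : Fin (3 + 1) => κ), ‖D p‖ ≤ St)
    {N : ℕ} (hN : 1 ≤ N) [NeZero (4 * N)] {t r : ℝ}
    (hT : ‖((code16SetE N).card : ℂ)⁻¹ *
        (∑ w ∈ code16SetE N, descend (fun p => ((A p)⁻¹ * B p).trace - ((A p)⁻¹ * C p * (A (p - c))⁻¹ * D p).trace)
          (gridPt (4 * N) w)) - t‖ ≤ r)
    {A₀ : ℝ} (hA₀ : Fintype.card n * (Ba * Sst + Ba * Ss * Ba * St) * codeTheta (aliasRatioL1 κ N) ≤ A₀) (lo : ℚ)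
    (hlo : ((lo : ℚ) : ℝ) ≤ t - r - A₀) : Rows b :=
  rowsOfOneLoopFormCode16E_routeA₂_ofSchedulesQ hb hκ hc hA hA' hBst hBs hBt hAn hAc hR ν₀ ν₁ S
    (hcert_of_records rec hvalid hsub e G X Y Z hG hsup) hRfl F hcertF hSst hSs hSt hN hT hA₀ lo hlo

/-- its level is `k₀ = 0`. [folklore] -/
theorem rowsOfOneLoopFormCode16E_routeA₂_ofRecords_k₀
    (hb : b 0 = (latticeKernel (fun p => ((A p)⁻¹ * B p).trace - ((A p)⁻¹ * C p * (A (p - c))⁻¹ * D p).trace) 0).re)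
    (hκ : 0 < κ) (hc : ∀ μ, (c μ).im = 0)
    (hA : MatTubeHol A (fun _ => κ)) (hA' : MatTubeHol (fun p => A (p - c)) (fun _ => κ))
    (hBst : MatTubeHol B (fun _ => κ)) (hBs : MatTubeHol C (fun _ => κ)) (hBt : MatTubeHol D (fun _ => κ))
    (hAn : MatNegTranspose A) (hAc : MatConjSymm A)
    {R : ℚ} (hR : π ≤ (R : ℝ)) (ν₀ ν₁ : Fin (3 + 1)) (S : (Fin (3 + 1) → Bool) → Sched 3)
    (rec : (Fin (3 + 1) → ℂ) × (Fin (3 + 1) → ℝ) → BlockLeafRecord 3)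
    (hvalid : ∀ bx ∈ quarterBoxesQ (fun _ : Fin (3 + 1) => κ) R ν₀ ν₁ S, (rec bx).Valid ∧ ((rec bx).B : ℝ) ≤ Ba)
    (hsub : ∀ bx ∈ quarterBoxesQ (fun _ : Fin (3 + 1) => κ) R ν₀ ν₁ S, Box bx.1 bx.2 ⊆ (rec bx).box)
    (e : v ⊕ u ≃ n) (G : (Fin (3 + 1) → ℂ) → Matrix v v ℂ) (X : (Fin (3 + 1) → ℂ) → Matrix v u ℂ)
    (Y : (Fin (3 + 1) → ℂ) → Matrix u v ℂ) (Z : (Fin (3 + 1) → ℂ) → Matrix u u ℂ)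
    (hG : ∀ bx ∈ quarterBoxesQ (fun _ : Fin (3 + 1) => κ) R ν₀ ν₁ S, ∀ q ∈ (rec bx).box,
      (A q).submatrix e e * fromBlocks (G q) (X q) (Y q) (Z q) = 1)
    (hsup : ∀ bx ∈ quarterBoxesQ (fun _ : Fin (3 + 1) => κ) R ν₀ ν₁ S,
      (∀ q ∈ (rec bx).box, ‖G q‖ ≤ (rec bx).a) ∧ (∀ q ∈ (rec bx).box, ‖X q‖ ≤ (rec bx).b) ∧
      (∀ q ∈ (rec bx).box, ‖Y q‖ ≤ (rec bx).c') ∧ (∀ q ∈ (rec bx).box, ‖Z q‖ ≤ (rec bx).e'))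
    (hRfl : ∀ (ν : Fin (3 + 1)) (p : Fin (3 + 1) → ℂ), (A (reflectAt ν p)).det = (A p).det)
    (F : Fin (3 + 1) → Sched 1)
    (hcertF : ∀ (i : Fin (3 + 1)), ∀ bx ∈ finRects (F i), ∀ τ x : ℝ, |τ - bx.1 0| ≤ bx.2 0 → |x - bx.1 1| ≤ bx.2 1 →
      IsUnit (A (i.insertNth ((x : ℂ) + ((τ * κ : ℝ) : ℂ) * I) fun _ => ((τ * κ : ℝ) : ℂ) * I)).det)
    (hSst : ∀ p ∈ VertexTori (fun _ : Fin (3 + 1) => κ), ‖B p‖ ≤ Sst)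
    (hSs : ∀ p ∈ VertexTori (fun _ : Fin (3 + 1) => κ), ‖C p‖ ≤ Ss)
    (hSt : ∀ p ∈ VertexTori (fun _ : Fin (3 + 1) => κ), ‖D p‖ ≤ St)
    {N : ℕ} (hN : 1 ≤ N) [NeZero (4 * N)] {t r : ℝ}
    (hT : ‖((code16SetE N).card : ℂ)⁻¹ *
        (∑ w ∈ code16SetE N, descend (fun p => ((A p)⁻¹ * B p).trace - ((A p)⁻¹ * C p * (A (p - c))⁻¹ * D p).trace)
          (gridPt (4 * N) w)) - t‖ ≤ r)
    {A₀ : ℝ} (hA₀ : Fintype.card n * (Ba * Sst + Ba * Ss * Ba * St) * codeTheta (aliasRatioL1 κ N) ≤ A₀) (lo : ℚ)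
    (hlo : ((lo : ℚ) : ℝ) ≤ t - r - A₀) :
    (rowsOfOneLoopFormCode16E_routeA₂_ofRecords hb hκ hc hA hA' hBst hBs hBt hAn hAc hR ν₀ ν₁ S rec hvalid hsub e G X Y Z hG hsup
      hRfl F hcertF hSst hSs hSt hN hT hA₀ lo hlo).k₀ = 0 := rfl

end Anchor

end

end Summit.QuantumFields.BalabanUV.Beta.ResolventLeafRecord
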